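import Literature.Probability.LatticeModels.ImprovedTreeDiagramBoundSum
import HarnessLib

/-!
# Sphere sums in the crossing estimates of Lemma 6.7 (Aizenman–Duminil-Copin 2021, (6.11)–(6.12))

Topic `Literature/Probability/LatticeModels`. Theorems only; **no named fact is introduced** (D-0026).

M. Aizenman, H. Duminil-Copin, Ann. of Math. **194** (2021) = arXiv:1912.07973, §6.2, proof of Lemma 6.7
(p. 25): the crossing probabilities are bounded by sums over spheres of products of two-point functions,
which are then estimated "where [we use] the lower bound (5.3) to bound the denominator and the Infrared
Bound (5.2) for the numerator": `∑_{v ∈ ∂Λ_R} ⟨σ_xσ_v⟩⟨σ_vσ_u⟩ ≤ C R³ · R⁻² · R⁻²`-type bounds,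
`∑_{v ∈ ∂Λ_R, w ∈ ∂Λ_N} ⟨σ_vσ_w⟩² ≤ C R³N³(R/N)⁴`-type bounds (there with `R = √(MN)`), and
`∑_{v ∈ ∂Λ_r} ⟨σ_{u_i}σ_v⟩ ≤ C r³/m²`.

This file proves the elementary deterministic versions on `ℤ⁴` for a non-negative function `S` obeying an
infrared-type bound `S(x) ≤ C_IR/‖x‖²_∞` (`x ≠ 0`), with the sphere cardinality `#∂Λ_m ≤ 216 m³`
(`card_sphere_four_le`):

* `sum_sphere_sphere_sq_le` — `∑_{s ∈ ∂Λ_a, z ∈ ∂Λ_b} S(z-s)² ≤ 216a³ · 216b³ · (C_IR/(b-a)²)²` (`1 ≤ a < b`);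
* `sum_sphere_mul_le` — `∑_{u ∈ ∂Λ_R} S(u)S(v-u) ≤ 216R³ (C_IR/R²)(C_IR/(R-‖v‖)²)` (`‖v‖ < R`);
* `sum_sphere_shift_le` — `∑_{u ∈ ∂Λ_r} S(u-v) ≤ 216r³ C_IR/(‖v‖-r)²` (`1 ≤ r < ‖v‖`).

## References

* M. Aizenman, H. Duminil-Copin, Ann. of Math. 194 (2021), arXiv:1912.07973, §6.2, proof of Lemma 6.7,
  (6.11)–(6.12) (p. 25) [AizenmanDuminilCopinAnnals2021].
-/

noncomputable section

open Finset

namespace Literature.Probability.LatticeModels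

variable {S : Site 4 → ℝ} {CIR : ℝ}

/-- The infrared-type bound at a site of sup norm at least `t ≥ 1`: `S(x) ≤ C_IR/t²`. [folklore] -/
theorem le_div_sq_of_supNorm_ge (hIR : ∀ x : Site 4, x ≠ 0 → S x ≤ CIR / (Site.supNorm x : ℝ) ^ 2)
    (hC : 0 ≤ CIR) {x : Site 4} {t : ℕ} (ht : 1 ≤ t) (hx : t ≤ Site.supNorm x) : S x ≤ CIR / (t : ℝ) ^ 2 := by
  have hx0 : x ≠ 0 := fun h => by
    rw [h, (Site.supNorm_eq_zero_iff (x := (0 : Site 4))).2 rfl] at hx; omega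
  refine (hIR x hx0).trans (div_le_div_of_nonneg_left hC (by positivity) ?_)
  have : (t : ℝ) ≤ Site.supNorm x := by exact_mod_cast hx
  exact pow_le_pow_left₀ (by positivity) this 2

/-- **The off-part sum `∑_{s ∈ ∂Λ_a, z ∈ ∂Λ_b} S(z-s)²`** (the bound (6.12) "`∑_{v ∈ ∂Λ_R, w ∈ ∂Λ_N} ⟨σ_vσ_w⟩² ≤
C₃R³N³(R/N)⁴`"): for `1 ≤ a < b`, `≤ 216a³ · 216b³ · (C_IR/(b-a)²)²`.
[cite: AizenmanDuminilCopinAnnals2021, arXiv:1912.07973 §6.2, proof of Lemma 6.7, (6.12) (p. 25)] -/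
theorem sum_sphere_sphere_sq_le (hS0 : ∀ x, 0 ≤ S x)
    (hIR : ∀ x : Site 4, x ≠ 0 → S x ≤ CIR / (Site.supNorm x : ℝ) ^ 2) (hC : 0 ≤ CIR) {a b : ℕ} (ha : 1 ≤ a)
    (hab : a < b) :
    ∑ s ∈ sphere 4 a, ∑ z ∈ sphere 4 b, S (z - s) ^ 2 ≤
      (216 * (a : ℝ) ^ 3) * (216 * (b : ℝ) ^ 3) * (CIR / ((b - a : ℕ) : ℝ) ^ 2) ^ 2 := by
  have hpt : ∀ s ∈ sphere 4 a, ∀ z ∈ sphere 4 b, S (z - s) ^ 2 ≤ (CIR / ((b - a : ℕ) : ℝ) ^ 2) ^ 2 := by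
    intro s hs z hz
    rw [mem_sphere] at hs hz
    refine pow_le_pow_left₀ (hS0 _) (le_div_sq_of_supNorm_ge hIR hC (by omega) ?_) 2
    have h := Site.supNorm_le_supNorm_sub_add z s
    omega
  calc ∑ s ∈ sphere 4 a, ∑ z ∈ sphere 4 b, S (z - s) ^ 2
      ≤ ∑ s ∈ sphere 4 a, ∑ z ∈ sphere 4 b, (CIR / ((b - a : ℕ) : ℝ) ^ 2) ^ 2 :=
        Finset.sum_le_sum fun s hs => Finset.sum_le_sum fun z hz => hpt s hs z hz
    _ = #(sphere 4 a) * (#(sphere 4 b) * (CIR / ((b - a : ℕ) : ℝ) ^ 2) ^ 2) := by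
        rw [Finset.sum_const, nsmul_eq_mul, Finset.sum_const, nsmul_eq_mul]
    _ ≤ (216 * (a : ℝ) ^ 3) * ((216 * (b : ℝ) ^ 3) * (CIR / ((b - a : ℕ) : ℝ) ^ 2) ^ 2) := by
        have h1 := card_sphere_four_le ha
        have h2 := card_sphere_four_le (show 1 ≤ b by omega)
        have h3 : 0 ≤ (CIR / ((b - a : ℕ) : ℝ) ^ 2) ^ 2 := by positivity
        exact mul_le_mul h1 (mul_le_mul_of_nonneg_right h2 h3) (by positivity) (by positivity)
    _ = _ := by ring

/-- **The backbone sum `∑_{u ∈ ∂Λ_R} S(u)S(v-u)`** (the numerator of (6.11)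
"`∑_{v ∈ ∂Λ_R} ⟨σ_{x_i}σ_v⟩⟨σ_vσ_{u_i}⟩ ≤ C₂R³·R⁻⁴·…`"): for `‖v‖ < R`,
`≤ 216R³ · (C_IR/R²) · (C_IR/(R-‖v‖)²)`. [cite: AizenmanDuminilCopinAnnals2021, arXiv:1912.07973 §6.2, proof of Lemma 6.7, (6.11) (p. 25)] -/
theorem sum_sphere_mul_le (hS0 : ∀ x, 0 ≤ S x)
    (hIR : ∀ x : Site 4, x ≠ 0 → S x ≤ CIR / (Site.supNorm x : ℝ) ^ 2) (hC : 0 ≤ CIR) {R : ℕ} {v : Site 4}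
    (hv : Site.supNorm v < R) :
    ∑ u ∈ sphere 4 R, S u * S (v - u) ≤
      (216 * (R : ℝ) ^ 3) * ((CIR / (R : ℝ) ^ 2) * (CIR / ((R - Site.supNorm v : ℕ) : ℝ) ^ 2)) := by
  have hR : 1 ≤ R := by omega
  have hpt : ∀ u ∈ sphere 4 R, S u * S (v - u) ≤ (CIR / (R : ℝ) ^ 2) * (CIR / ((R - Site.supNorm v : ℕ) : ℝ) ^ 2) := by
    intro u hu
    rw [mem_sphere] at hu
    refine mul_le_mul (le_div_sq_of_supNorm_ge hIR hC hR hu.ge) (le_div_sq_of_supNorm_ge hIR hC (by omega) ?_)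
      (hS0 _) (by positivity)
    have h := Site.supNorm_le_supNorm_sub_add u v
    rw [Site.supNorm_sub_comm] at h
    omega
  calc ∑ u ∈ sphere 4 R, S u * S (v - u) ≤ ∑ u ∈ sphere 4 R, (CIR / (R : ℝ) ^ 2) * (CIR / ((R - Site.supNorm v : ℕ) : ℝ) ^ 2) :=
        Finset.sum_le_sum hpt
    _ = #(sphere 4 R) * ((CIR / (R : ℝ) ^ 2) * (CIR / ((R - Site.supNorm v : ℕ) : ℝ) ^ 2)) := by
        rw [Finset.sum_const, nsmul_eq_mul]
    _ ≤ _ := mul_le_mul_of_nonneg_right (card_sphere_four_le hR) (by positivity)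

/-- **The inward backbone sum `∑_{u ∈ ∂Λ_r} S(u-v)`** ("`∑_{v ∈ ∂Λ_r} ⟨σ_{u_i}σ_v⟩ … ≤ C₅r³/m²`"): for
`1 ≤ r < ‖v‖`, `≤ 216r³ · C_IR/(‖v‖-r)²`. [cite: AizenmanDuminilCopinAnnals2021, arXiv:1912.07973 §6.2, proof of Lemma 6.7, last display (p. 25)] -/
theorem sum_sphere_shift_le (hIR : ∀ x : Site 4, x ≠ 0 → S x ≤ CIR / (Site.supNorm x : ℝ) ^ 2) (hC : 0 ≤ CIR)
    {r : ℕ} (hr : 1 ≤ r) {v : Site 4} (hv : r < Site.supNorm v) :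
    ∑ u ∈ sphere 4 r, S (u - v) ≤ (216 * (r : ℝ) ^ 3) * (CIR / ((Site.supNorm v - r : ℕ) : ℝ) ^ 2) := by
  have hpt : ∀ u ∈ sphere 4 r, S (u - v) ≤ CIR / ((Site.supNorm v - r : ℕ) : ℝ) ^ 2 := by
    intro u hu
    rw [mem_sphere] at hu
    refine le_div_sq_of_supNorm_ge hIR hC (by omega) ?_
    have h := Site.supNorm_le_supNorm_sub_add v u
    rw [Site.supNorm_sub_comm] at h
    omega
  calc ∑ u ∈ sphere 4 r, S (u - v) ≤ ∑ u ∈ sphere 4 r, CIR / ((Site.supNorm v - r : ℕ) : ℝ) ^ 2 := Finset.sum_le_sum hpt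
    _ = #(sphere 4 r) * (CIR / ((Site.supNorm v - r : ℕ) : ℝ) ^ 2) := by rw [Finset.sum_const, nsmul_eq_mul]
    _ ≤ _ := mul_le_mul_of_nonneg_right (card_sphere_four_le hr) (by positivity)

end Literature.Probability.LatticeModels
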